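import Mathlib
import HarnessLib
import Summits.NavierStokesRegularity.NavierStokesRegularity.Theorems.PoloidalWindowDoorLrcModEntireJetCertPsatzElimLazy

/-!
# Jet-certificate checker — lazy materialisation with a PREFETCH CACHE (splitting one law's materialisation across stages)

Experiment cell `ns-wall-extremal`, arm C (PREREG-WALL-1 §C; C1b all-tilt cell T1′(5,3)), seat ns-wall-eng-6 g3, 2026-08-29.
`--supports stmt-NavierStokesRegularity-19708` (instrument).  Generic; no Navier–Stokes content.

WHY: in `…JetCertPsatzElimLazy` an original law is materialised inside the ONE step that cites it; for a law of ≈ 6·10⁴ terms under ≈ 60 logged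
substitutions that single step can approach the gate's per-file budget.  Here the lazy state carries, in addition, a CACHE of partially materialised
laws `(k, m, P)` = «original law `k` with the first `m` log entries applied»; a `prefetch k m` step extends (or creates) the cache entry of law `k`
up to log length `m`, and `elim`/`force` steps continue from the cache entry when one exists.  So one law's materialisation can be spread over several
steps and hence several stages.  Side conditions, semantics and the conclusion `Kills` are those of `…ElimLazy` / `…ElimI`, word for word.

SOUNDNESS: the invariant `CDatum` = `LazyDatum` ∧ «every cached polynomial vanishes at the point»; a cache entry is a materialisation of a vanishing
law under logged relations, hence vanishes (`ev_materialize_eq_zero`); continuing a materialisation from a vanishing cached polynomial again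
preserves vanishing.  The numbers `m` are bookkeeping only (which suffix of the log is still to be applied); soundness does not depend on them.

* `CState`, `CStep`; `cacheFind`, `materializeUpTo`, `clawAt` (+ `ev_clawAt_eq_zero`); `runC` (+ `cDatum_runC`);
* `cStageCheck` (+ **`cDatum_of_cStageCheck`**), `cFinalCheck` (+ **`not_cDatum_of_cFinalCheck`**), **`kills_of_cStages`**;
* self-test (`decide +kernel`): the toy transcript with law 1 prefetched in a stage of its own.

WHAT THIS IS NOT: not a claim about Navier–Stokes, not a certificate; plumbing for exact census rows of an ansatz class. [folklore]
-/

noncomputable section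

-- the summit and its single sub-problem share the name (CONVENTIONS §1), as in every Theorems file
set_option linter.dupNamespace false

namespace Summit.NavierStokesRegularity.NavierStokesRegularity.Theorems.PoloidalWindowDoorLrcModEntireJetCertPsatzElimLazyCache

open _root_.Topology _root_.Filter Set
open Literature.Analysis.ValidatedNumerics Literature.Analysis.ValidatedNumerics.QMvPoly
open Literature.Analysis.Calculus.MvPoly
open Summit.NavierStokesRegularity.NavierStokesRegularity.Theorems.PoloidalWindowDoorLrcModEntireJetCertDefs
open Summit.NavierStokesRegularity.NavierStokesRegularity.Theorems.PoloidalWindowDoorLrcModEntireJetCertTree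
open Summit.NavierStokesRegularity.NavierStokesRegularity.Theorems.PoloidalWindowDoorLrcModEntireJetCertFast2
open Summit.NavierStokesRegularity.NavierStokesRegularity.Theorems.PoloidalWindowDoorLrcModEntireJetCertGauge
open Summit.NavierStokesRegularity.NavierStokesRegularity.Theorems.PoloidalWindowDoorLrcModEntireJetCertPsatz
open Summit.NavierStokesRegularity.NavierStokesRegularity.Theorems.PoloidalWindowDoorLrcModEntireJetCertPsatzSubst
open Summit.NavierStokesRegularity.NavierStokesRegularity.Theorems.PoloidalWindowDoorLrcModEntireJetCertPsatzElim
open Summit.NavierStokesRegularity.NavierStokesRegularity.Theorems.PoloidalWindowDoorLrcModEntireJetCertPsatzElimN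
open Summit.NavierStokesRegularity.NavierStokesRegularity.Theorems.PoloidalWindowDoorLrcModEntireJetCertPsatzElimG
open Summit.NavierStokesRegularity.NavierStokesRegularity.Theorems.PoloidalWindowDoorLrcModEntireJetCertPsatzElimH
open Summit.NavierStokesRegularity.NavierStokesRegularity.Theorems.PoloidalWindowDoorLrcModEntireJetCertPsatzElimI
open Summit.NavierStokesRegularity.NavierStokesRegularity.Theorems.PoloidalWindowDoorLrcModEntireJetCertPsatzElimHStage
open Summit.NavierStokesRegularity.NavierStokesRegularity.Theorems.PoloidalWindowDoorLrcModEntireJetCertPsatzElimIStage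
open Summit.NavierStokesRegularity.NavierStokesRegularity.Theorems.PoloidalWindowDoorLrcModEntireJetCertPsatzElimLazy

variable {n : ℕ}

/-! ### State, steps, cache -/

/-- Lazy state with a prefetch cache: entries `(k, m, P)` = original law `k` with the first `m` log entries applied. [folklore] -/
structure CState where
  /-- the underlying lazy state (log, adjoined laws, pins) -/
  base : LState
  /-- partially materialised original laws -/
  cache : List (ℕ × ℕ × QMvPoly)

/-- Steps: the two `LStep`s and `prefetch k m` (materialise law `k` up to the first `m` log entries and cache it). [folklore] -/
inductive CStep : Type
  | step (s : LStep)
  | prefetch (k m : ℕ)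

/-- The cache entry of law `k`, if any: `(m, P)`. [folklore] -/
def cacheFind (k : ℕ) : List (ℕ × ℕ × QMvPoly) → Option (ℕ × QMvPoly)
  | [] => none
  | (k', m, P) :: rest => if k' = k then some (m, P) else cacheFind k rest

/-- A cached polynomial of a cache all of whose entries vanish, vanishes. [folklore] -/
theorem ev_cacheFind_eq_zero {z : EuclideanSpace ℝ (Fin n)} (k : ℕ) : ∀ (cache : List (ℕ × ℕ × QMvPoly)) {m : ℕ} {P : QMvPoly},
    (∀ e ∈ cache, ev n e.2.2 z = 0) → cacheFind k cache = some (m, P) → ev n P z = 0 := by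
  intro cache
  induction cache with
  | nil => intro m P _ h; simp [cacheFind] at h
  | cons e rest ih =>
    intro m P hc h
    obtain ⟨k', m', P'⟩ := e
    simp only [cacheFind] at h
    split_ifs at h with hk
    · simp only [Option.some.injEq, Prod.mk.injEq] at h
      obtain ⟨-, rfl⟩ := h
      exact hc (k', m', P') (List.mem_cons_self ..)
    · exact ih (fun e he => hc e (List.mem_cons_of_mem _ he)) h

/-- Law `k` materialised up to the first `m` log entries, continuing from the cache when possible (the whole log when `m` exceeds its length). [folklore] -/
def materializeUpTo (n g : ℕ) (hyp : ℕ → QMvPoly) (s : CState) (k m : ℕ) : QMvPoly :=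
  match cacheFind k s.cache with
  | some (m0, P0) => materialize n g ((s.base.log.take m).drop m0) P0 (presentArr n P0)
  | none => materialize n g (s.base.log.take m) (hyp k) (presentArr n (hyp k))

/-- `materializeUpTo` of a vanishing original law vanishes (given the logged relations, a vanishing cache and `z_g ≠ 0`). [folklore] -/
theorem ev_materializeUpTo_eq_zero {N : ℕ} {hyp : ℕ → QMvPoly} {s : CState} {z : EuclideanSpace ℝ (Fin n)} (g : Fin n) (hg : z g ≠ 0)
    (hh : ∀ k, k < N → ev n (hyp k) z = 0) (hσ : ∀ t ∈ s.base.log, ∃ hi : t.i < n, ev n t.c z * z ⟨t.i, hi⟩ = ev n t.num z)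
    (hc : ∀ e ∈ s.cache, ev n e.2.2 z = 0) {k : ℕ} (hk : k < N) (m : ℕ) : ev n (materializeUpTo n g hyp s k m) z = 0 := by
  have hsub : ∀ (l : List LSub), (∀ t ∈ l, t ∈ s.base.log) → ∀ t ∈ l, ∃ hi : t.i < n, ev n t.c z * z ⟨t.i, hi⟩ = ev n t.num z :=
    fun l hl t ht => hσ t (hl t ht)
  unfold materializeUpTo
  cases hf : cacheFind k s.cache with
  | none =>
    simp only []
    exact ev_materialize_eq_zero z g hg _ _ _ (hsub _ (fun t ht => List.mem_of_mem_take ht)) (hh k hk)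
  | some mp =>
    obtain ⟨m0, P0⟩ := mp
    simp only []
    exact ev_materialize_eq_zero z g hg _ _ _ (hsub _ (fun t ht => List.mem_of_mem_take (List.mem_of_mem_drop ht))) (ev_cacheFind_eq_zero k s.cache hc hf)

/-- The law a step cites: original law `k < N` materialised under the WHOLE log (from the cache when present), else adjoined law `k − N`. [folklore] -/
def clawAt (n g N : ℕ) (hyp : ℕ → QMvPoly) (s : CState) (k : ℕ) : QMvPoly :=
  if k < N then materializeUpTo n g hyp s k s.base.log.length else s.base.adj.getD (k - N) []

/-! ### The invariant and the replay -/

/-- **A CACHED LAZY DATUM**: a lazy datum of the base state whose point also annihilates every cached polynomial. [folklore] -/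
def CDatum (n N : ℕ) (hyp : ℕ → QMvPoly) (s : CState) : Prop :=
  ∃ z : EuclideanSpace ℝ (Fin n), (∀ k, k < N → ev n (hyp k) z = 0) ∧ (∀ t ∈ s.base.log, ∃ hi : t.i < n, ev n t.c z * z ⟨t.i, hi⟩ = ev n t.num z) ∧
    (∀ a ∈ s.base.adj, ev n a z = 0) ∧ (∀ π ∈ s.base.pins, ev n π z ≠ 0) ∧ (∀ e ∈ s.cache, ev n e.2.2 z = 0)

/-- A cited law vanishes at the point of a cached lazy datum (given `z_g ≠ 0`). [folklore] -/
theorem ev_clawAt_eq_zero {N : ℕ} {hyp : ℕ → QMvPoly} {s : CState} {z : EuclideanSpace ℝ (Fin n)} (g : Fin n) (hg : z g ≠ 0)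
    (hh : ∀ k, k < N → ev n (hyp k) z = 0) (hσ : ∀ t ∈ s.base.log, ∃ hi : t.i < n, ev n t.c z * z ⟨t.i, hi⟩ = ev n t.num z)
    (ha : ∀ a ∈ s.base.adj, ev n a z = 0) (hc : ∀ e ∈ s.cache, ev n e.2.2 z = 0) (k : ℕ) : ev n (clawAt n g N hyp s k) z = 0 := by
  unfold clawAt
  split_ifs with hk
  · exact ev_materializeUpTo_eq_zero g hg hh hσ hc hk _
  · exact ev_getD_eq_zero ha (k - N)

/-- **CACHED LAZY REPLAY**: `…ElimLazy.runL` with law look-up through the cache, plus `prefetch`. [folklore] -/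
def runC (n g N : ℕ) (hyp : ℕ → QMvPoly) : List CStep → CState → Option CState
  | [], s => some s
  | (.prefetch k m) :: rest, s =>
      if decide (k < N) && decide (g < n) && hasVarPin n g s.base.pins then
        runC n g N hyp rest { base := s.base, cache := (k, m, materializeUpTo n g hyp s k m) :: s.cache }
      else none
  | (.step (.elim k i κ pe keep)) :: rest, s =>
      let L := clawAt n g N hyp s k
      let c := coeffIn i L
      let num := QMvPoly.smul (-1) (restIn i L)
      if decide (i < n) && decide (g < n) && hasVarPin n g s.base.pins && decide (κ ≠ 0) && decide (degIn i L ≤ 1) &&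
          polyEq c (QMvPoly.smul κ (pinProductN s.base.pins pe)) then
        runC n g N hyp rest
          { base := { log := logStep keep s.base.log ⟨i, num, c⟩,
                      adj := s.base.adj.map (substStripI n g i num c),
                      pins := s.base.pins.map (substLawN i num c) },
            cache := s.cache }
      else none
  | (.step (.force k j κ pe e)) :: rest, s =>
      let L := clawAt n g N hyp s k
      if decide (j < n) && decide (g < n) && hasVarPin n g s.base.pins && decide (κ ≠ 0) && decide (1 ≤ e) &&
          polyEq L (QMvPoly.smul κ (mulN (pinProductN s.base.pins pe) (powQN (QMvPoly.var n j) e))) then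
        runC n g N hyp rest { base := { log := s.base.log, adj := s.base.adj ++ [QMvPoly.var n j], pins := s.base.pins }, cache := s.cache }
      else none

/-- **SOUNDNESS OF THE CACHED LAZY REPLAY.** [folklore] -/
theorem cDatum_runC (g N : ℕ) (hyp : ℕ → QMvPoly) : ∀ (steps : List CStep) {s s' : CState},
    runC n g N hyp steps s = some s' → CDatum n N hyp s → CDatum n N hyp s' := by
  intro steps
  induction steps with
  | nil =>
    intro s s' h hd
    simp only [runC, Option.some.injEq] at h
    subst h; exact hd
  | cons st rest ih =>
    intro s s' h hd
    rcases st with ⟨⟨k, i, κ, pe, keep⟩ | ⟨k, j, κ, pe, e⟩⟩ | ⟨k, m⟩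
    · -- elim
      simp only [runC] at h
      split_ifs at h with hc
      simp only [Bool.and_eq_true, decide_eq_true_eq] at hc
      obtain ⟨⟨⟨⟨⟨hi, hgn⟩, hvp⟩, hκ⟩, hdeg⟩, hcf⟩ := hc
      obtain ⟨z, hh, hσ, ha, hp, hcache⟩ := hd
      set L := clawAt n g N hyp s k with hL
      set c := coeffIn i L with hc_def
      set num := QMvPoly.smul (-1) (restIn i L) with hnum
      have hzg : z ⟨g, hgn⟩ ≠ 0 := zg_ne_zero_of_hasVarPin (g := ⟨g, hgn⟩) hvp hp
      have hcz : ev n c z ≠ 0 := by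
        rw [ev_eq_of_polyEq hcf z, ev_smul, ev_pinProductN]
        exact mul_ne_zero (by exact_mod_cast hκ) (ev_pinProduct_ne_zero z s.base.pins pe hp)
      have hLz : ev n L z = 0 := ev_clawAt_eq_zero ⟨g, hgn⟩ hzg hh hσ ha hcache k
      have hlin := ev_linear_split z ⟨i, hi⟩ L hdeg
      have hzi : ev n c z * z ⟨i, hi⟩ = ev n num z := by
        rw [hnum, ev_smul]; push_cast
        have : z ⟨i, hi⟩ * ev n c z + ev n (restIn i L) z = 0 := by rw [← hLz, hlin]
        linarith
      refine ih h ⟨z, hh, ?_, ?_, ?_, hcache⟩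
      · intro t ht
        dsimp only at ht
        rcases mem_logStep ht with ht' | rfl
        · exact hσ t ht'
        · exact ⟨hi, hzi⟩
      · intro a ha'
        dsimp only at ha'
        obtain ⟨P, hP, rfl⟩ := List.mem_map.1 ha'
        exact ev_substStripI_eq_zero z ⟨g, hgn⟩ ⟨i, hi⟩ num c hzg hzi (ha P hP)
      · intro π' hπ'
        dsimp only at hπ'
        obtain ⟨P, hP, rfl⟩ := List.mem_map.1 hπ'
        exact ev_substLawN_ne_zero z ⟨i, hi⟩ num c hzi hcz (hp P hP)
    · -- force
      simp only [runC] at h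
      split_ifs at h with hc
      simp only [Bool.and_eq_true, decide_eq_true_eq] at hc
      obtain ⟨⟨⟨⟨⟨hj, hgn⟩, hvp⟩, hκ⟩, he⟩, hform⟩ := hc
      obtain ⟨z, hh, hσ, ha, hp, hcache⟩ := hd
      have hzg : z ⟨g, hgn⟩ ≠ 0 := zg_ne_zero_of_hasVarPin (g := ⟨g, hgn⟩) hvp hp
      have hLz : ev n (clawAt n g N hyp s k) z = 0 := ev_clawAt_eq_zero ⟨g, hgn⟩ hzg hh hσ ha hcache k
      rw [ev_eq_of_polyEq hform z, ev_smul, ev_mulN, ev_pinProductN, ev_powQN, ev_var z ⟨j, hj⟩] at hLz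
      have hzj : z ⟨j, hj⟩ = 0 := by
        have h1 : (κ : ℝ) ≠ 0 := by exact_mod_cast hκ
        have h2 := ev_pinProduct_ne_zero z s.base.pins pe hp
        have h3 : z ⟨j, hj⟩ ^ e = 0 := by
          rcases mul_eq_zero.1 hLz with h | h
          · exact absurd h h1
          · rcases mul_eq_zero.1 h with h' | h'
            · exact absurd h' h2
            · exact h'
        exact pow_eq_zero_iff (by omega) |>.1 h3
      refine ih h ⟨z, hh, hσ, ?_, hp, hcache⟩
      intro a ha'
      dsimp only at ha'
      rcases List.mem_append.1 ha' with h' | h'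
      · exact ha a h'
      · rw [List.mem_singleton.1 h', ev_var z ⟨j, hj⟩]; exact hzj
    · -- prefetch
      simp only [runC] at h
      split_ifs at h with hc
      simp only [Bool.and_eq_true, decide_eq_true_eq] at hc
      obtain ⟨⟨hk, hgn⟩, hvp⟩ := hc
      obtain ⟨z, hh, hσ, ha, hp, hcache⟩ := hd
      have hzg : z ⟨g, hgn⟩ ≠ 0 := zg_ne_zero_of_hasVarPin (g := ⟨g, hgn⟩) hvp hp
      refine ih h ⟨z, hh, hσ, ha, hp, ?_⟩
      intro e he
      dsimp only at he
      rcases List.mem_cons.1 he with rfl | he'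
      · exact ev_materializeUpTo_eq_zero ⟨g, hgn⟩ hzg hh hσ hcache hk m
      · exact hcache e he'

/-! ### Declared states, stages, final slice, assembly -/

/-- Member-by-member equality of caches (`k`, `m` equal, polynomials `polyEq`). [folklore] -/
def cacheEq : List (ℕ × ℕ × QMvPoly) → List (ℕ × ℕ × QMvPoly) → Bool
  | [], [] => true
  | (k, m, P) :: as, (k', m', P') :: bs => decide (k = k') && decide (m = m') && polyEq P P' && cacheEq as bs
  | _, _ => false

/-- `cacheEq` caches vanish together. [folklore] -/
theorem ev_of_cacheEq (z : EuclideanSpace ℝ (Fin n)) : ∀ {a b : List (ℕ × ℕ × QMvPoly)}, cacheEq a b = true →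
    (∀ e ∈ a, ev n e.2.2 z = 0) → ∀ e ∈ b, ev n e.2.2 z = 0 := by
  intro a
  induction a with
  | nil =>
    intro b h _ e he
    cases b with
    | nil => simp at he
    | cons _ _ => simp [cacheEq] at h
  | cons x xs ih =>
    intro b h hz e he
    cases b with
    | nil => obtain ⟨k, m, P⟩ := x; simp [cacheEq] at h
    | cons y ys =>
      obtain ⟨k, m, P⟩ := x
      obtain ⟨k', m', P'⟩ := y
      simp only [cacheEq, Bool.and_eq_true, decide_eq_true_eq] at h
      obtain ⟨⟨⟨-, -⟩, hP⟩, hrest⟩ := h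
      rcases List.mem_cons.1 he with rfl | he'
      · have hx := hz (k, m, P) (List.mem_cons_self ..)
        dsimp only at hx ⊢
        rw [← ev_eq_of_polyEq hP z]; exact hx
      · exact ih hrest (fun e' he'' => hz e' (List.mem_cons_of_mem _ he'')) e he'

/-- A cached lazy datum of a state is one of any declared copy of it. [folklore] -/
theorem cDatum_of_eq {N : ℕ} {hyp : ℕ → QMvPoly} {s t : CState} (h1 : logEq s.base.log t.base.log = true) (h2 : polyListEq s.base.adj t.base.adj = true)
    (h3 : polyListEq s.base.pins t.base.pins = true) (h4 : cacheEq s.cache t.cache = true) (hd : CDatum n N hyp s) : CDatum n N hyp t := by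
  obtain ⟨z, hh, hσ, ha, hp, hc⟩ := hd
  refine ⟨z, hh, rel_of_logEq z h1 hσ, ?_, ?_, ev_of_cacheEq z h4 hc⟩
  · intro a ha'
    obtain ⟨P, hP, hev⟩ := ev_mem_of_polyListEq h2 z a ha'
    rw [← hev]; exact ha P hP
  · intro π hπ'
    obtain ⟨P, hP, hev⟩ := ev_mem_of_polyListEq h3 z π hπ'
    rw [← hev]; exact hp P hP

/-- **CACHED LAZY STAGE CHECK** (Boolean). [folklore] -/
def cStageCheck (n g N : ℕ) (hyp : ℕ → QMvPoly) (steps : List CStep) (s s' : CState) : Bool :=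
  match runC n g N hyp steps s with
  | none => false
  | some t => logEq t.base.log s'.base.log && polyListEq t.base.adj s'.base.adj && polyListEq t.base.pins s'.base.pins && cacheEq t.cache s'.cache

/-- **SOUNDNESS OF A CACHED LAZY STAGE.** [folklore] -/
theorem cDatum_of_cStageCheck {g N : ℕ} {hyp : ℕ → QMvPoly} {steps : List CStep} {s s' : CState}
    (h : cStageCheck n g N hyp steps s s' = true) (hd : CDatum n N hyp s) : CDatum n N hyp s' := by
  cases hr : runC n g N hyp steps s with
  | none => simp [cStageCheck, hr] at h
  | some t =>
    simp only [cStageCheck, hr, Bool.and_eq_true] at h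
    exact cDatum_of_eq h.1.1.1 h.1.1.2 h.1.2 h.2 (cDatum_runC g N hyp steps hr hd)

/-- **CACHED LAZY FINAL CHECK** (Boolean): last steps, then the point-level certificate on `(adjoined laws, pins)`. [folklore] -/
def cFinalCheck (n g N : ℕ) (hyp : ℕ → QMvPoly) (steps : List CStep) (s : CState) (c : PsatzLeaf) : Bool :=
  match runC n g N hyp steps s with
  | none => false
  | some t => pointCheckP n t.base.adj t.base.pins [] [] c

/-- **SOUNDNESS OF THE CACHED FINAL SLICE.** [folklore] -/
theorem not_cDatum_of_cFinalCheck {g N : ℕ} {hyp : ℕ → QMvPoly} {steps : List CStep} {s : CState} {c : PsatzLeaf}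
    (h : cFinalCheck n g N hyp steps s c = true) : ¬ CDatum n N hyp s := by
  intro hd
  cases hr : runC n g N hyp steps s with
  | none => simp [cFinalCheck, hr] at h
  | some t =>
    simp only [cFinalCheck, hr] at h
    obtain ⟨z, -, -, ha, hp, -⟩ := cDatum_runC g N hyp steps hr hd
    exact not_pointDatum_of_pointCheckP h ⟨z, ha, hp, by simp, by simp⟩

/-- **ASSEMBLY OF A CACHED LAZY STAGED KILL**: the statement of `kills_of_lazyStages`, starting from the empty log, no adjoined laws, the cell
pins plus the twist pin, and the empty cache. [folklore] -/
theorem kills_of_cStages {N : ℕ} {hyp : ℕ → QMvPoly} {hyps pins : List QMvPoly} {J : List ℕ} {sK : CState}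
    (hhyps : hyps = (List.range N).map hyp)
    (hchain : CDatum n N hyp { base := { log := [], adj := [], pins := pins ++ [sumSq n J] }, cache := [] } → CDatum n N hyp sK)
    (hfin : ¬ CDatum n N hyp sK) : Kills n hyps pins [] [] J := by
  intro z hh hp hz hq j hjJ hj
  by_contra hne
  refine hfin (hchain ⟨z, ?_, by simp, by simp, ?_, by simp⟩)
  · intro k hk
    exact hh (hyp k) (by rw [hhyps]; exact List.mem_map.2 ⟨k, List.mem_range.2 hk, rfl⟩)
  · intro π hπ
    rcases List.mem_append.1 hπ with h' | h'
    · exact hp π h'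
    · rw [List.mem_singleton.1 h', ev_sumSq]
      have hnn : ∀ x ∈ J.map (fun j => ev n (QMvPoly.var n j) z * ev n (QMvPoly.var n j) z), (0 : ℝ) ≤ x := by
        intro x hx
        obtain ⟨j', -, rfl⟩ := List.mem_map.1 hx
        exact mul_self_nonneg _
      have hmem : ev n (QMvPoly.var n j) z * ev n (QMvPoly.var n j) z ∈
          J.map (fun j => ev n (QMvPoly.var n j) z * ev n (QMvPoly.var n j) z) := List.mem_map.2 ⟨j, hjJ, rfl⟩
      have hle := List.single_le_sum hnn _ hmem
      have hpos : 0 < ev n (QMvPoly.var n j) z * ev n (QMvPoly.var n j) z := by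
        rw [ev_var z ⟨j, hj⟩]; exact mul_self_pos.2 hne
      exact ne_of_gt (lt_of_lt_of_le hpos hle)

/-! ### Self-test (`decide +kernel`): the toy transcript with law 1 prefetched in a stage of its own -/

/-- State after `elim 0 1 1 [1] keep` (empty cache). [folklore] -/
def toyC1 : CState := { base := toyS1, cache := [] }

/-- State after `prefetch 1 1`: law 1 materialised under the (whole, one-entry) log = `X₂`, cached. [folklore] -/
def toyC2 : CState := { base := toyS1, cache := [(1, 1, [([0, 0, 1], (1 : ℚ))])] }

/-- State after `force 1 2 1 [] 1` read from the cache: `X₂` adjoined. [folklore] -/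
def toyC3 : CState := { base := toyS2, cache := toyC2.cache }

/-- Stage 1 (elim). [folklore] -/
theorem example_cstage1 :
    cStageCheck 3 0 2 toyHyp [.step (.elim 0 1 1 [1] true)] { base := { log := [], adj := [], pins := [QMvPoly.var 3 0, sumSq 3 [2]] }, cache := [] } toyC1 = true := by
  decide +kernel

/-- Stage 2 (prefetch only). [folklore] -/
theorem example_cstage2 : cStageCheck 3 0 2 toyHyp [.prefetch 1 1] toyC1 toyC2 = true := by
  decide +kernel

/-- Stage 3 (force, citing the cached law). [folklore] -/
theorem example_cstage3 : cStageCheck 3 0 2 toyHyp [.step (.force 1 2 1 [] 1)] toyC2 toyC3 = true := by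
  decide +kernel

/-- Final slice. [folklore] -/
theorem example_cfinal : cFinalCheck 3 0 2 toyHyp [.step (.elim 2 2 1 [] false)] toyC3 { steps := [], comb := [], e := [0, 1], sos0 := [], sosG := [] } = true := by
  decide +kernel

-- The toy kill assembled from the three cached-lazy stages and the final slice (an `example`: the landed toy theorem is not restated).
example :
    Kills 3 [[([1, 1, 0], (1 : ℚ)), ([0, 0, 0], (-1 : ℚ)), ([2, 0, 0], (-1 : ℚ))], [([0, 1, 1], (1 : ℚ)), ([1, 0, 1], (-1 : ℚ))]]
      [QMvPoly.var 3 0] [] [] [2] :=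
  kills_of_cStages (N := 2) (hyp := toyHyp) (by decide)
    (fun hd => cDatum_of_cStageCheck example_cstage3 (cDatum_of_cStageCheck example_cstage2 (cDatum_of_cStageCheck example_cstage1 hd)))
    (not_cDatum_of_cFinalCheck example_cfinal)

end Summit.NavierStokesRegularity.NavierStokesRegularity.Theorems.PoloidalWindowDoorLrcModEntireJetCertPsatzElimLazyCache

end
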